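import Literature.NumberTheory.Li1992.RallisLocalFactorSplitAssembly
import Literature.NumberTheory.Li1992.RallisLocalFactorUnramifiedNonsplit
import Literature.NumberTheory.Li1992.RallisLocalFactorNonsplitPlace
import Literature.NumberTheory.Automorphic.UnitaryGroupNonsplitPlace
import HarnessLib

/-!
# [Li1992, Thm 2.1 (27)] — the local factors at ALL finite places: non-zero test vectors everywhere, spherical almost everywhere

J.-S. Li, J. reine angew. Math. **428** (1992), Thm 2.1 (27) p. 184, L-3: «for almost all `v` the local integral is computed with the
unramified data» — and is then non-zero.  In the tree's currency (`ω_v = toRep ∘ s_v` of a restricted family `𝓢` of local splittings,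
`χ_{1,v}` the local component of a continuous unitary character `χ₁` of `E¹(𝔸_{F,f})`): for all but finitely many finite places `v` of `F`
(split OR non-split in `E`), for every left-invariant measure `dh` on `U(J₁)(F_v)` finite on compacts and charging open sets,
`∫_{U(J₁)(F_v)} ⟨ω_v(h·1) 1_{𝒪_vᴺ}, 1_{𝒪_vᴺ}⟩ conj χ_{1,v}(h) dh ≠ 0` — ★ `RallisLocalFactorUnramifiedNonsplit` (non-split `v`: the factor is
`dh(U(J₁)(F_v)) · μ'ᴺ(𝒪_vᴺ)`) and ★ `RallisLocalFactorSplitAssembly` (split `v`: `dh(U(J₁)(𝒪_v)) · μ'ᴺ(𝒪_vᴺ) · (1 − q^{-N}) ∕ |1 − u χ̄ q^{-N/2}|²`).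

* **`eventually_localFactor_unitVec_ne_zero`** — the spherical vector works for almost all `v`;
* **`exists_testVector_localFactor_ne_zero_of_three_le`** — at EVERY finite place `v` (`N ≥ 3`) some `Φ_v ∈ 𝒮(F_vᴺ)` has
  `∫ ⟨ω_v(h·1)Φ_v, Φ_v⟩ conj χ_{1,v}(h) dh ≠ 0`: split `v` by ★ `RallisLocalFactorSplitRamified`, non-split `v` by ★
  `RallisLocalFactorNonsplitPlace` ([MVW, Chap. 3 IV.2] non-vanishing of the `χ_v`-coinvariants, isotropy from `N ≥ 3`).

KERNEL only: theorems, no definition, no named fact, no `sorry`.  Cell hodgecm-mathlib, FLOOR 0, programme P4 (F4), crux item H413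
(`--supports stmt-HodgeConjecture-24833`).  HC_CM is proved only modulo the printed citations until rung 0 closes; nothing here is a claim about them.

## References
* [Li1992] J.-S. Li, J. reine angew. Math. 428 (1992) 177–217 — Thm 2.1 (27) p. 184 L-3.
* [TateThesis1967] J. Tate, in Cassels–Fröhlich (1967), Ch. XV §3.2 Lemma 3.2.1.
-/

set_option autoImplicit false

noncomputable section

open NumberField IsDedekindDomain MeasureTheory Filter Set
open scoped Matrix NNReal Topology ComplexConjugate
open Literature.RepresentationTheory Literature.RepresentationTheory.HeisenbergGroup
open Literature.NumberTheory.Automorphic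
open Literature.NumberTheory.Automorphic.UnitaryGroup
open Literature.NumberTheory.Automorphic.Liu2021
open Literature.NumberTheory.GaloisRepresentations.IsNonarchimedeanLocalField

namespace Literature.NumberTheory.GelbartRogawski1991.UnitaryDualPair.LocalSplitting.FinLocalSplittings

variable {F : Type} [Field F] [NumberField F] {E : Type} [Field E] [NumberField E] [Algebra F E]
  [Algebra.IsQuadraticExtension F E] {c : E ≃ₐ[F] E} {N : ℕ} {δ : E} {hcδ : c δ = -δ} {hδ : δ ≠ 0} {d : F}
  {hd : δ * δ = algebraMap F E d} {T : Matrix (Fin N) (Fin N) F} {hT : T.IsSymm}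
  {J : Matrix (Fin N) (Fin N) E} {hJ : J = T.map (algebraMap F E)}
  (𝓢 : FinLocalSplittings F E c N hcδ hδ hd T hT hJ) (J₁ : Matrix (Fin 1) (Fin 1) E) (hJ₁ : J₁ 0 0 ≠ 0)
  (hTd : IsUnit T.det)

include hTd in
/-- **[Li1992 (27), p. 184 L-3]: FOR ALMOST ALL `v` THE UNRAMIFIED LOCAL FACTOR IS NON-ZERO.**  For a restricted family `𝓢` of local splittings
with `ω_v` `L²(μ'_vᴺ)`-isometric, `N ≥ 1`, and a continuous unitary character `χ₁` of `E¹(𝔸_{F,f})`: for all but finitely many `v`, for every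
left-invariant measure `dh` on `U(J₁)(F_v)` finite on compacts and charging open sets,
`∫_{U(J₁)(F_v)} ⟨ω_v(h·1) 1_{𝒪_vᴺ}, 1_{𝒪_vᴺ}⟩_{μ'_vᴺ} conj χ_{1,v}(h) dh ≠ 0`.
[cite: Li1992, Thm 2.1 (27) p. 184 L-3] [cite: TateThesis1967, §3.2 Lemma 3.2.1] -/
theorem eventually_localFactor_unitVec_ne_zero [NeZero N] (hJ₁c : (J₁.map c)ᵀ = J₁)
    {χ₁ : finAdelicOne F E c →* ℂˣ} (hχ₁ : Continuous χ₁) (hχ₁u : ∀ x, ‖((χ₁ x : ℂˣ) : ℂ)‖ = 1)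
    [∀ v : HeightOneSpectrum (𝓞 F), MeasurableSpace (v.adicCompletion F)] [∀ v : HeightOneSpectrum (𝓞 F), BorelSpace (v.adicCompletion F)]
    (μ' : ∀ v : HeightOneSpectrum (𝓞 F), Measure (v.adicCompletion F)) [∀ v, (μ' v).IsAddHaarMeasure]
    (hL2 : ∀ v : HeightOneSpectrum (𝓞 F), (𝓢.omegaLoc v).IsL2Isometric (Measure.pi fun _ : Fin N => μ' v)) :
    ∀ᶠ v : HeightOneSpectrum (𝓞 F) in cofinite,
      ∀ [MeasurableSpace (localPi E c 1 J₁ v)] [BorelSpace (localPi E c 1 J₁ v)] (dh : Measure (localPi E c 1 J₁ v))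
        [dh.IsMulLeftInvariant] [IsFiniteMeasureOnCompacts dh] [dh.IsOpenPosMeasure],
        (∫ h, (∫ x, ((𝓢.omegaLoc v (localCenter E c N J J₁ hJ₁ v h) (unitVec F (Fin N) v) :
                SchwartzBruhat (Fin N → v.adicCompletion F)) : (Fin N → v.adicCompletion F) → ℂ) x *
              conj (((unitVec F (Fin N) v : SchwartzBruhat (Fin N → v.adicCompletion F)) : (Fin N → v.adicCompletion F) → ℂ) x)
              ∂(Measure.pi fun _ : Fin N => μ' v)) *
            conj ((localCharOfCenter F E c J₁ hJ₁ χ₁ v h : ℂˣ) : ℂ) ∂dh) ≠ 0 := by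
  have hc : c ≠ 1 := by
    rintro rfl
    exact hδ (self_eq_neg.1 (by simpa only [AlgEquiv.one_apply] using hcδ))
  filter_upwards [𝓢.eventually_localFactor_unitVec_of_nonsplit J₁ hJ₁ hχ₁,
    𝓢.eventually_forall_localFactor_unitVec_ne_zero_of_split' J₁ hJ₁ hTd hJ₁c hχ₁ hχ₁u μ' hL2] with v hns hsp
  intro _ _ dh _ _ _
  obtain ⟨w⟩ := (inferInstance : Nonempty (PlacesOver E v))
  by_cases hw : c • w.1 = w.1
  · -- non-split `v`: the factor is `dh(U(J₁)(F_v)) · μ'ᴺ(𝒪_vᴺ)`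
    haveI : SecondCountableTopology (v.adicCompletion F) := secondCountableTopology_localField _
    haveI : CompactSpace (localPi E c 1 J₁ v) := compactSpace_localPi_one_of_smul_eq c J₁ hc hJ₁ w hw
    rw [hns w hw dh (Measure.pi fun _ : Fin N => μ' v) (isOpen_integralBox (K := F) (ι := Fin N) (v := v)).measurableSet]
    refine mul_ne_zero (Complex.ofReal_ne_zero.2 (ENNReal.toReal_pos ?_ (isCompact_univ.measure_lt_top (μ := dh)).ne).ne')
      (Complex.ofReal_ne_zero.2 (ENNReal.toReal_pos ?_ ((isCompact_integralBox (K := F) (ι := Fin N) (v := v)).measure_lt_top).ne).ne')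
    · exact (isOpen_univ.measure_pos dh univ_nonempty).ne'
    · exact ((isOpen_integralBox (K := F) (ι := Fin N) (v := v)).measure_pos _ ⟨0, zero_mem_integralBox F (Fin N) v⟩).ne'
  · -- split `v`
    exact hsp w hw dh

include hTd in
/-- **[Li1992 (27)]: AT EVERY FINITE PLACE A TEST VECTOR WITH NON-ZERO LOCAL FACTOR** (`N ≥ 3`, `χ₁` continuous unitary, `dh` finite on
compacts charging open sets, `μ'` an additive Haar measure on `F_v`): there is `Φ ∈ 𝒮(F_vᴺ)` with
`∫_{U(J₁)(F_v)} ⟨ω_v(h·1)Φ, Φ⟩_{μ'ᴺ} conj χ_{1,v}(h) dh ≠ 0` — at a split `v` the ramified test vector of ★ `RallisLocalFactorSplitRamified`, at a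
non-split `v` a `χ_{1,v}`-eigenvector ([MVW, Chap. 3 IV.2 Lemme], ★ `RallisLocalFactorNonsplitPlace`; `(E_vᴺ, J)` is isotropic for `N ≥ 3`).
[cite: Li1992, Thm 2.1 (27) p. 184; Thm 5.4 a) p. 206] [cite: MoeglinVignerasWaldspurger1987, Chap. 3 §IV.2 Lemme (p. 76)] -/
theorem exists_testVector_localFactor_ne_zero_of_three_le (h3 : 3 ≤ N) (hJ₁c : (J₁.map c)ᵀ = J₁) (v : HeightOneSpectrum (𝓞 F))
    {χ₁ : finAdelicOne F E c →* ℂˣ} (hχ₁ : Continuous χ₁) (hχ₁u : ∀ x, ‖((χ₁ x : ℂˣ) : ℂ)‖ = 1)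
    [MeasurableSpace (localPi E c 1 J₁ v)] [BorelSpace (localPi E c 1 J₁ v)] (dh : Measure (localPi E c 1 J₁ v))
    [IsFiniteMeasureOnCompacts dh] [dh.IsOpenPosMeasure]
    [MeasurableSpace (v.adicCompletion F)] [BorelSpace (v.adicCompletion F)] (μ' : Measure (v.adicCompletion F)) [μ'.IsAddHaarMeasure] :
    ∃ Φ : SchwartzBruhat (Fin N → v.adicCompletion F),
      (∫ h, (∫ x, ((𝓢.omegaLoc v (localCenter E c N J J₁ hJ₁ v h) Φ :
            SchwartzBruhat (Fin N → v.adicCompletion F)) : (Fin N → v.adicCompletion F) → ℂ) x *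
          conj (((Φ : SchwartzBruhat (Fin N → v.adicCompletion F)) : (Fin N → v.adicCompletion F) → ℂ) x)
          ∂(Measure.pi fun _ : Fin N => μ')) * conj ((localCharOfCenter F E c J₁ hJ₁ χ₁ v h : ℂˣ) : ℂ) ∂dh) ≠ 0 := by
  haveI : NeZero N := ⟨by omega⟩
  have hc : c ≠ 1 := by
    rintro rfl
    exact hδ (self_eq_neg.1 (by simpa only [AlgEquiv.one_apply] using hcδ))
  obtain ⟨w⟩ := (inferInstance : Nonempty (PlacesOver E v))
  by_cases hw : c • w.1 = w.1
  · -- non-split `v`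
    haveI : SecondCountableTopology (v.adicCompletion F) := secondCountableTopology_localField _
    haveI : CompactSpace (localPi E c 1 J₁ v) := compactSpace_localPi_one_of_smul_eq c J₁ hc hJ₁ w hw
    have hE : IsField (LocalRing E v) := LocalRing.isField_of_smul_eq c hc w hw
    have hca : (⇑c ∘ ⇑(algebraMap F E)) = ⇑(algebraMap F E) := funext fun x => AlgEquiv.commutes c x
    have hJh : (J.map c)ᵀ = J := by
      rw [hJ, Matrix.map_map, hca, ← Matrix.transpose_map, hT.eq]
    have hJdet : J.det ≠ 0 := by
      rw [hJ, ← RingHom.mapMatrix_apply, ← RingHom.map_det]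
      exact (map_ne_zero_iff _ (algebraMap F E).injective).2 hTd.ne_zero
    obtain ⟨Φ, -, -, -, hne⟩ := Li1992.exists_localFactor_ne_zero_of_nonsplit_of_three_le F E c N δ hcδ hδ d hd T hT hTd J hJ v
      (hE := hE) (hJh := hJh) (hJdet := hJdet) (s := 𝓢.s v) (hs := 𝓢.proj_s v) (hsm := 𝓢.smooth v) (J₁ := J₁) (hJ₁ := hJ₁)
      (χ := localCharOfCenter F E c J₁ hJ₁ χ₁ v) (hχu := norm_localCharOfCenter F E c J₁ hJ₁ hχ₁u v)
      (hχc := continuous_coe_localCharOfCenter F E c J₁ hJ₁ hχ₁ v) (μX := Measure.pi fun _ : Fin N => μ') (dh := dh) (h3 := h3)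
    exact ⟨Φ, hne⟩
  · -- split `v`
    obtain ⟨Φ, -, hne⟩ := 𝓢.exists_testVector_localFactor_ne_zero_of_split_localCharOfCenter J₁ hJ₁ hTd hJ₁c v w hw hχ₁ dh μ'
    exact ⟨Φ, hne⟩

end Literature.NumberTheory.GelbartRogawski1991.UnitaryDualPair.LocalSplitting.FinLocalSplittings

end
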